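import Summits.Ventures.QEC.Census.LP.LP96w8.Distance
import Summits.Ventures.QEC.Census.LPTyped
import HarnessLib

/-!
# `LP96w8` IS Panteleev–Kalachev's `LP(A, A*)` (§III.D Example 3), `A = (x^{E i j})` 4 × 4 over `𝔽₂[x]/(x³ − 1)` — the census row `[[96, 18, 6]]` on the TYPED construction

The census object `LP96w8.cert.code _` (explicit check words, `Census/LP/LP96w8/Cert.lean`, qec-type-07's KERNEL row via the
MitmK lane; census id `LP_4x4_l3_E0-0-0-0.0-0-0-1.0-1-2-0.0-2-1-1`, cell D.1-lite) is, along the layout bijections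
`LPTyped.rowEquiv2` / `colEquiv2` (`r = 3·(4i + s) + a`, `q = 3·c + t` with `c = 4j + s` for the `A ⊗ I` columns and
`c = 16 + 4s' + j'` for the `I ⊗ A*` columns — census/search-4 s4lib `lp(A, A*)`), EXACTLY the flat check-matrix pair
`(𝔅H_X(A,A*), 𝔅H_Z(A,A*))` of the typed lifted product `LPTyped.lpCodeSelf 3 E` (`Literature/…/LiftedProduct.lean`:
`LiftedProduct.xMatrix A (blockStar A)` / `zMatrix A (blockStar A)` over `3 × 3` circulant blocks): `HX_eq`, `HZ_eq` by
`decide +kernel` on the product-free entry formulas `LiftedProduct.xMatrix_eq_of_xEntry` / `zMatrix_eq_of_zEntry`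
(48 × 96 entries each). Hence type-07's KERNEL theorem `LP96w8.isCode` transports (type-05 FACT P,
`CSSCode.isCode_iff_of_submatrix`) to **`isCode_lp : (lpCodeSelf 3 E).IsCode 96 18 6`** — a `[[96,18,6]]` theorem about the
TYPED `LP(A, A*)` object; with `LiftedProduct.dX_eq_dZ_of_lp_self` this family is `X/Z`-balanced by theorem.
Tier KERNEL, axioms standard, no `native_decide`. qec-search-4 g3 (lead block 51 (3) GO; type-07's Cert/MitmK/Distance untouched).
-/

set_option autoImplicit false

namespace Summit.Ventures.QEC.Census.LP96w8

open Matrix Literature.InformationTheory.QuantumCodes LiftedProduct Summit.Ventures.QEC.Census.LPTyped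

/-- Exponent matrix `E` of `A` (4 × 4; `A i j = x^{E i j}`). (definition) -/
def E : Fin 4 → Fin 4 → ℕ := ![![0, 0, 0, 0], ![0, 0, 0, 1], ![0, 1, 2, 0], ![0, 2, 1, 1]]

/-- **The census object's `H^X` is `𝔅(H_X(A, A*))` relabelled** (`decide +kernel` over all `48 × 96` entries of the
product-free entry formula). -/
theorem HX_eq : (LP96w8.cert.code LP96w8.commOK_cert).HX =
    (lpCodeSelf 3 E).HX.submatrix ((finCongr (by decide)).trans (rowEquiv2 4 4 3))
      ((finCongr (by decide)).trans (colEquiv2 4 4 3)) := by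
  change rowMatrix _ _ = (xMatrix _ _).submatrix _ _
  rw [xMatrix_eq_of_xEntry]
  decide +kernel

/-- **The census object's `H^Z` is `𝔅(H_Z(A, A*))` relabelled** (`decide +kernel`, `48 × 96` entries). -/
theorem HZ_eq : (LP96w8.cert.code LP96w8.commOK_cert).HZ =
    (lpCodeSelf 3 E).HZ.submatrix ((finCongr (by decide)).trans (rowEquiv2 4 4 3))
      ((finCongr (by decide)).trans (colEquiv2 4 4 3)) := by
  change rowMatrix _ _ = (zMatrix _ _).submatrix _ _
  rw [zMatrix_eq_of_zEntry]
  decide +kernel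

/-- **Panteleev–Kalachev's `LP(A, A*)` with `A = (x^{E i j})`, `E = [0 0 0 0; 0 0 0 1; 0 1 2 0; 0 2 1 1]` over `𝔽₂[x]/(x³ − 1)`
is a `[[96, 18, 6]]` code** — the KERNEL census row `LP96w8.isCode` (qec-type-07) transported to the typed construction by
type-05's FACT P. [cite: PanteleevKalachev2022LP] -/
theorem isCode_lp : (lpCodeSelf 3 E).IsCode 96 18 6 :=
  (CSSCode.isCode_iff_of_submatrix HX_eq HZ_eq 96 18 6).1 isCode

/-- `d_X = d_Z` for this `LP(A, A*)` code from the family theorem (`LiftedProduct.dX_eq_dZ_of_lp_self`), independently of the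
certificate. -/
theorem dX_eq_dZ_typed : (lpCodeSelf 3 E).dX = (lpCodeSelf 3 E).dZ :=
  dX_eq_dZ_of_lp_self (A := monoBlocks 3 E) rfl rfl

/-- **The census object is a lifted-product code** in the sense of qec-type-07's predicate `IsLiftedProduct` (PARTITION row 07):
witnesses `ℓ = 3`, `A = monoBlocks 3 E` (4 × 4), `B = A* = blockStar A` (4 × 4), the layout bijections `rowEquiv2`/`colEquiv2`,
element-wise commutation `elementwiseCommute_mono_star`, and `HX_eq` / `HZ_eq`. (appended, qec-search-4 g3)
[cite: PanteleevKalachev2022LP, §III.D Example 3 (arXiv:2012.04068 chunk p0011 L60-64)] -/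
theorem isLiftedProduct : IsLiftedProduct (LP96w8.cert.code LP96w8.commOK_cert).HX (LP96w8.cert.code LP96w8.commOK_cert).HZ :=
  ⟨3, 4, 4, 4, 4, monoBlocks 3 E, blockStar (monoBlocks 3 E), (finCongr (by decide)).trans (rowEquiv2 4 4 3),
    (finCongr (by decide)).trans (rowEquiv2 4 4 3), (finCongr (by decide)).trans (colEquiv2 4 4 3),
    elementwiseCommute_mono_star 3 E, HX_eq, HZ_eq⟩

end Summit.Ventures.QEC.Census.LP96w8
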